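import Literature.NumberTheory.Sieve.CFSemigroupEigenfunction
import Literature.NumberTheory.Sieve.CFSemigroupBowen
import HarnessLib

/-!
# Uniqueness of the positive eigenfunction of the transfer operator of `Γ_A`

Support file (all results proved) for the named fact
`Literature.NumberTheory.Sieve.MageeOhWinter2019_uniformCounting` (`CFSemigroupCounting.lean`).
[MageeOhWinter2019, Thm. 10 (2)]: the eigenvalue `e^{P(f)}` of `L_f` "belongs to a UNIQUE positive
eigenfunction `h_f`" (Lipschitz). `CFSemigroupEigenfunction.lean` proves existence for the
transfer operator `L_s` of the continued fractions semigroup; here we prove uniqueness up to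
scalars in the class of Lipschitz functions on `[0,1]`:

* `cfTransfer_eigen_eq_zero_of_vanish_on_cantor` — a Lipschitz eigenfunction (eigenvalue
  `λ_s = e^{P_A(s)}`) vanishing on the Cantor set `E_A` vanishes on `[0,1]`: `λⁿ g(x) = L_sⁿ g(x)`
  is a sum over words `w ∈ Aⁿ` of `|M_w'(x)|^s g(M_w x)`, and `M_w x` is within `2 q(w)^{-2}` of a
  point of `E_A` (`abs_cfMoeb_sub_cfValue_le`), so `|λⁿ g(x)| ≤ K · 4·2⁻ⁿ · L_sⁿ1(x) ≤ 4K 4^s 2⁻ⁿ λⁿ`;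
* `cfTransfer_eigen_vanish_on_cantor` — a nonnegative continuous eigenfunction vanishing at one
  point of `[0,1]` vanishes on `E_A` (all terms of `L_sⁿ g(x₀) = 0` vanish, and the points
  `M_w x₀` accumulate at every point of `E_A`);
* `cfTransfer_eigenfunction_unique` — two Lipschitz eigenfunctions `h₁, h₂` on `[0,1]` with
  `h₂ > 0` are proportional: `h₁ = t h₂` with `t = min h₁/h₂`.

## References

* M. Magee, H. Oh, D. Winter, J. reine angew. Math. 753 (2019) 89–135, Thm. 10.
  [MageeOhWinter2019]
* W. Parry, M. Pollicott, Astérisque 187–188 (1990), Thm. 2.2 (uniqueness of the positive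
  eigenfunction of the Ruelle operator).
-/

noncomputable section

open Filter Set
open scoped Topology

namespace Literature.NumberTheory.Sieve

variable {A : Finset ℕ} {n : ℕ}

/-! ### Word maps contract `[0,1]` onto their cylinders -/

/-- `|M_w u - M_w v| ≤ |u - v| / q(w)²` on `[0,1]` (`|M_w'| = denom^{-2} ≤ q^{-2}`). [folklore] -/
theorem abs_cfMoeb_sub_cfMoeb_le {w : Fin n → ℕ} (hw : ∀ i, 1 ≤ w i) {u v : ℝ}
    (hu : u ∈ Icc (0 : ℝ) 1) (hv : v ∈ Icc (0 : ℝ) 1) :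
    |cfMoeb (cfMat w) u - cfMoeb (cfMat w) v| ≤ |u - v| / (cfQ w : ℝ) ^ 2 := by
  have hdu := cfDenom_cfMat_pos hw hu
  have hdv := cfDenom_cfMat_pos hw hv
  have hqu := (cfDenom_cfMat_mem hw hu).1
  have hqv := (cfDenom_cfMat_mem hw hv).1
  have hq1 : (1 : ℝ) ≤ (cfQ w : ℝ) := by exact_mod_cast one_le_cfQ hw
  have hdet : (cfMat w 0 0 : ℝ) * cfMat w 1 1 - cfMat w 0 1 * cfMat w 1 0 = (-1) ^ n := by
    have h := det_cfWord (cfExt w) n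
    rw [Matrix.det_fin_two] at h
    unfold cfMat
    exact_mod_cast h
  have hdiff : cfMoeb (cfMat w) u - cfMoeb (cfMat w) v =
      (-1) ^ n * (u - v) / (cfDenom (cfMat w) u * cfDenom (cfMat w) v) := by
    simp only [cfMoeb, cfDenom] at hdu hdv ⊢
    rw [div_sub_div _ _ hdu.ne' hdv.ne', ← hdet]
    congr 1
    ring
  rw [hdiff, abs_div, abs_mul, abs_pow, abs_neg, abs_one, one_pow, one_mul,
    abs_of_pos (mul_pos hdu hdv)]
  exact div_le_div_of_nonneg_left (abs_nonneg _) (by positivity)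
    (by nlinarith [mul_le_mul hqu hqv (by positivity) hdu.le])

/-- `M_n(d) · 0 = x_n(d)` (the `n`-th convergent). [folklore] -/
theorem cfMoeb_cfWord_zero (d : ℕ → ℕ) (n : ℕ) : cfMoeb (cfWord d n) 0 = cfConv d n := by
  simp [cfMoeb, cfConv, cfNum, cfDen]

/-- **Word maps land near the Cantor set:** for a digit sequence `d` (digits `≥ 1`) and
`u ∈ [0,1]`, `|M_n(d) u - [0; d]| ≤ 2/q_n²`. [folklore] -/
theorem abs_cfMoeb_sub_cfValue_le {d : ℕ → ℕ} (hd : ∀ i, 1 ≤ d i) (n : ℕ) {u : ℝ}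
    (hu : u ∈ Icc (0 : ℝ) 1) : |cfMoeb (cfWord d n) u - cfValue d| ≤ 2 / (cfDen d n : ℝ) ^ 2 := by
  -- `cfWord d n = cfMat (first n digits)`
  set w : Fin n → ℕ := fun i => d i with hw_def
  have hw : ∀ i, 1 ≤ w i := fun i => hd i
  have hmat : cfMat w = cfWord d n := cfWord_congr fun i hi => by rw [cfExt_of_lt _ hi]
  have hq : (cfQ w : ℝ) = cfDen d n := by
    simp only [cfQ, cfDen]
    rw [show cfWord (cfExt w) n = cfWord d n from hmat]
  have h1 := abs_cfMoeb_sub_cfMoeb_le hw hu (v := 0) ⟨le_rfl, zero_le_one⟩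
  rw [hmat, hq, sub_zero, abs_of_nonneg hu.1] at h1
  have h2 := abs_cfValue_sub_cfConv_le hd n
  rw [← cfMoeb_cfWord_zero] at h2
  have h3 : |u| / (cfDen d n : ℝ) ^ 2 ≤ 1 / (cfDen d n : ℝ) ^ 2 :=
    div_le_div_of_nonneg_right (by rw [abs_of_nonneg hu.1]; exact hu.2) (by positivity)
  have htri := abs_sub_le (cfMoeb (cfWord d n) u) (cfMoeb (cfWord d n) 0) (cfValue d)
  rw [abs_sub_comm (cfMoeb (cfWord d n) 0) (cfValue d)] at htri
  have hu' : u / (cfDen d n : ℝ) ^ 2 ≤ 1 / (cfDen d n : ℝ) ^ 2 := by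
    rw [abs_of_nonneg hu.1] at h3; exact h3
  have e : (2 : ℝ) / (cfDen d n : ℝ) ^ 2 = 1 / (cfDen d n : ℝ) ^ 2 + 1 / (cfDen d n : ℝ) ^ 2 := by ring
  rw [e]
  linarith

/-! ### Eigenfunctions: iterates and linearity on `[0,1]` -/

/-- Iterating the eigen-equation: `L_s h = λ h` on `[0,1]` implies `L_sⁿ h = λⁿ h` on `[0,1]`.
[folklore] -/
theorem cfTransfer_iterate_of_eigen (hA : ∀ a ∈ A, 1 ≤ a) {s c : ℝ} {h : ℝ → ℝ}
    (heig : ∀ x ∈ Icc (0 : ℝ) 1, cfTransfer A s h x = c * h x) :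
    ∀ (n : ℕ) {x : ℝ}, x ∈ Icc (0 : ℝ) 1 → (cfTransfer A s)^[n] h x = c ^ n * h x
  | 0, x, _ => by simp
  | n + 1, x, hx => by
      rw [Function.iterate_succ_apply', cfTransfer, pow_succ]
      have hrec : ∀ a ∈ A, (cfTransfer A s)^[n] h (1 / (x + a)) = c ^ n * h (1 / (x + a)) :=
        fun a ha => cfTransfer_iterate_of_eigen hA heig n (one_div_add_mem_Icc (hA a ha) hx)
      rw [Finset.sum_congr rfl fun a ha => by rw [hrec a ha]]
      have hL := heig x hx
      rw [cfTransfer] at hL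
      calc ∑ a ∈ A, ((x + a) ^ 2) ^ (-s) * (c ^ n * h (1 / (x + a)))
          = c ^ n * ∑ a ∈ A, ((x + a) ^ 2) ^ (-s) * h (1 / (x + a)) := by
            rw [Finset.mul_sum]
            exact Finset.sum_congr rfl fun a _ => by ring
        _ = c ^ n * c * h x := by rw [hL]; ring

/-- The transfer operator is linear: `L_s (h₁ - t h₂) = L_s h₁ - t L_s h₂`. [folklore] -/
theorem cfTransfer_sub_smul (s t : ℝ) (h₁ h₂ : ℝ → ℝ) (x : ℝ) :
    cfTransfer A s (fun y => h₁ y - t * h₂ y) x = cfTransfer A s h₁ x - t * cfTransfer A s h₂ x := by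
  simp only [cfTransfer, mul_sub, Finset.sum_sub_distrib, Finset.mul_sum]
  congr 1
  exact Finset.sum_congr rfl fun a _ => by ring

/-! ### Vanishing on the Cantor set propagates -/

section Unique

variable (hA : ∀ a ∈ A, 1 ≤ a)
include hA

/-- `2/q_n² ≤ 4 · 2⁻ⁿ` along a digit sequence with digits `≥ 1` (`q_n² ≥ 2^{n-1}`). [folklore] -/
theorem two_div_cfDen_sq_le {d : ℕ → ℕ} (hd : ∀ i, 1 ≤ d i) (n : ℕ) :
    2 / (cfDen d n : ℝ) ^ 2 ≤ 4 * (1 / 2 : ℝ) ^ n := by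
  have _ := hA
  have hgrow : (2 : ℝ) ^ (n - 1) ≤ (cfDen d n : ℝ) ^ 2 := by
    rcases n with _ | k
    · simp
    · have h1 := pow_le_cfDen_mul hd k
      have h2 := cfDen_le_succ hd k
      have h3 : (0 : ℤ) ≤ cfDen d (k + 1) := zero_le_one.trans (one_le_cfDen hd _)
      have h4 : (2 : ℤ) ^ k ≤ cfDen d (k + 1) ^ 2 := by
        rw [sq]; nlinarith [mul_le_mul_of_nonneg_right h2 h3]
      rw [Nat.add_sub_cancel]
      exact_mod_cast h4
  have h2pos : (0 : ℝ) < (2 : ℝ) ^ (n - 1) := by positivity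
  calc 2 / (cfDen d n : ℝ) ^ 2 ≤ 2 / (2 : ℝ) ^ (n - 1) :=
        div_le_div_of_nonneg_left (by norm_num) h2pos hgrow
    _ ≤ 4 * (1 / 2 : ℝ) ^ n := by
        rcases n with _ | k
        · norm_num
        · rw [Nat.add_sub_cancel]
          have e : (4 : ℝ) * (1 / 2) ^ (k + 1) = 2 / 2 ^ k := by
            rw [one_div_pow, pow_succ]
            field_simp
            ring
          rw [e]

/-- **A Lipschitz eigenfunction vanishing on `E_A` vanishes on `[0,1]`.** [folklore] -/
theorem cfTransfer_eigen_eq_zero_of_vanish_on_cantor (hne : A.Nonempty) {s : ℝ} (hs : 0 ≤ s) {g : ℝ → ℝ} {K : ℝ}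
    (hK : ∀ x ∈ Icc (0 : ℝ) 1, ∀ y ∈ Icc (0 : ℝ) 1, |g x - g y| ≤ K * |x - y|)
    (hvan : ∀ y ∈ cfCantorSet A, g y = 0)
    (heig : ∀ x ∈ Icc (0 : ℝ) 1, cfTransfer A s g x = cfEig A s * g x) :
    ∀ x ∈ Icc (0 : ℝ) 1, g x = 0 := by
  intro x hx
  obtain ⟨a₀, ha₀⟩ := hne
  have hK0 : 0 ≤ K := by
    have h := hK 0 ⟨le_rfl, zero_le_one⟩ 1 ⟨zero_le_one, le_rfl⟩
    have : (0 : ℝ) ≤ |g 0 - g 1| := abs_nonneg _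
    rw [show |(0 : ℝ) - 1| = 1 by norm_num] at h
    linarith
  -- `|λⁿ g(x)| ≤ 4 K 4^s 2⁻ⁿ λⁿ` for every `n`
  have hbound : ∀ n : ℕ, |g x| ≤ 4 * K * (4 : ℝ) ^ s * (1 / 2 : ℝ) ^ n := by
    intro n
    have hlam : 0 < cfEig A s ^ n := pow_pos (cfEig_pos s) n
    have hiter := cfTransfer_iterate_of_eigen hA heig n hx
    rw [cfTransfer_iterate hA s g n hx, cfTransferSum] at hiter
    -- each term: `|g(M_w x)| ≤ K · 2/q_w² ≤ K · 4 · 2⁻ⁿ`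
    have hterm : ∀ w : Fin n → A,
        |((cfDenom (cfMat fun i => (w i : ℕ)) x) ^ 2) ^ (-s) * g (cfMoeb (cfMat fun i => (w i : ℕ)) x)| ≤
          ((cfDenom (cfMat fun i => (w i : ℕ)) x) ^ 2) ^ (-s) * (K * (4 * (1 / 2 : ℝ) ^ n)) := by
      intro w
      have hw : ∀ i, 1 ≤ (fun i => (w i : ℕ)) i := one_le_coe_digit hA w
      have hwt : 0 ≤ ((cfDenom (cfMat fun i => (w i : ℕ)) x) ^ 2) ^ (-s) :=
        Real.rpow_nonneg (sq_nonneg _) _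
      rw [abs_mul, abs_of_nonneg hwt]
      refine mul_le_mul_of_nonneg_left ?_ hwt
      -- the nearby Cantor point: digits `w` then `a₀` for ever
      set d : ℕ → ℕ := fun i => if h : i < n then ((w ⟨i, h⟩ : A) : ℕ) else a₀ with hd_def
      have hdA : ∀ i, d i ∈ A := fun i => by
        simp only [hd_def]; split_ifs
        · exact (w _).2
        · exact ha₀
      have hd1 : ∀ i, 1 ≤ d i := fun i => hA _ (hdA i)
      have hmat : cfMat (fun i => (w i : ℕ)) = cfWord d n :=
        cfWord_congr fun i hi => by rw [cfExt_of_lt _ hi]; simp [hd_def, hi]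
      have hy : cfValue d ∈ cfCantorSet A := ⟨d, hdA, rfl⟩
      have hyI : cfValue d ∈ Icc (0 : ℝ) 1 := cfValue_mem_Icc hd1
      have hMx : cfMoeb (cfMat fun i => (w i : ℕ)) x ∈ Icc (0 : ℝ) 1 := cfMoeb_cfMat_mem hw hx
      have hnear : |cfMoeb (cfMat fun i => (w i : ℕ)) x - cfValue d| ≤ 2 / (cfDen d n : ℝ) ^ 2 := by
        rw [hmat]; exact abs_cfMoeb_sub_cfValue_le hd1 n hx
      have h2q : 2 / (cfDen d n : ℝ) ^ 2 ≤ 4 * (1 / 2 : ℝ) ^ n := two_div_cfDen_sq_le hA hd1 n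
      calc |g (cfMoeb (cfMat fun i => (w i : ℕ)) x)|
          = |g (cfMoeb (cfMat fun i => (w i : ℕ)) x) - g (cfValue d)| := by rw [hvan _ hy, sub_zero]
        _ ≤ K * |cfMoeb (cfMat fun i => (w i : ℕ)) x - cfValue d| := hK _ hMx _ hyI
        _ ≤ K * (4 * (1 / 2 : ℝ) ^ n) := mul_le_mul_of_nonneg_left (hnear.trans h2q) hK0
    -- sum up: `|λⁿ g x| ≤ K 4 2⁻ⁿ W_n 1 (x) ≤ K 4 2⁻ⁿ Z_n(s) ≤ K 4 2⁻ⁿ 4^s λⁿ`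
    have hsum : |cfEig A s ^ n * g x| ≤ (K * (4 * (1 / 2 : ℝ) ^ n)) * cfTransferSum A s n (fun _ => 1) x := by
      rw [← hiter, cfTransferSum, Finset.mul_sum]
      refine (Finset.abs_sum_le_sum_abs _ _).trans (Finset.sum_le_sum fun w _ => ?_)
      rw [mul_one, mul_comm (K * (4 * (1 / 2 : ℝ) ^ n))]
      exact hterm w
    have hW := cfTransferSum_one_le hA hs n hx
    have hZ := cfPartition_le_exp hA ⟨a₀, ha₀⟩ hs n
    rw [← cfEig_pow] at hZ
    rw [abs_mul, abs_of_pos hlam] at hsum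
    have hchain : cfEig A s ^ n * |g x| ≤ (K * (4 * (1 / 2 : ℝ) ^ n)) * ((4 : ℝ) ^ s * cfEig A s ^ n) :=
      hsum.trans (mul_le_mul_of_nonneg_left (hW.trans hZ) (by positivity))
    have hchain' : cfEig A s ^ n * |g x| ≤
        cfEig A s ^ n * (K * (4 * (1 / 2 : ℝ) ^ n) * (4 : ℝ) ^ s) :=
      hchain.trans (le_of_eq (by ring))
    have : |g x| ≤ K * (4 * (1 / 2 : ℝ) ^ n) * (4 : ℝ) ^ s := le_of_mul_le_mul_left hchain' hlam
    calc |g x| ≤ K * (4 * (1 / 2 : ℝ) ^ n) * (4 : ℝ) ^ s := this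
      _ = 4 * K * (4 : ℝ) ^ s * (1 / 2 : ℝ) ^ n := by ring
  -- let `n → ∞`
  have hlim : Tendsto (fun n : ℕ => 4 * K * (4 : ℝ) ^ s * (1 / 2 : ℝ) ^ n) atTop (𝓝 0) := by
    have h := (tendsto_pow_atTop_nhds_zero_of_lt_one (by norm_num : (0 : ℝ) ≤ 1 / 2)
      (by norm_num)).const_mul (4 * K * (4 : ℝ) ^ s)
    rwa [mul_zero] at h
  have h0 : |g x| ≤ 0 := ge_of_tendsto' hlim hbound
  exact abs_eq_zero.1 (le_antisymm h0 (abs_nonneg _))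

/-- **A nonnegative continuous eigenfunction vanishing at one point vanishes on `E_A`.**
[folklore] -/
theorem cfTransfer_eigen_vanish_on_cantor {s : ℝ} {g : ℝ → ℝ} (hcont : ContinuousOn g (Icc 0 1))
    (hpos : ∀ x ∈ Icc (0 : ℝ) 1, 0 ≤ g x)
    (heig : ∀ x ∈ Icc (0 : ℝ) 1, cfTransfer A s g x = cfEig A s * g x)
    {x₀ : ℝ} (hx₀ : x₀ ∈ Icc (0 : ℝ) 1) (hzero : g x₀ = 0) :
    ∀ y ∈ cfCantorSet A, g y = 0 := by
  rintro y ⟨d, hdA, rfl⟩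
  have hd1 : ∀ i, 1 ≤ d i := fun i => hA _ (hdA i)
  -- all terms of `L_sⁿ g (x₀) = λⁿ g(x₀) = 0` vanish
  have hterms : ∀ (n : ℕ) (w : Fin n → A), g (cfMoeb (cfMat fun i => (w i : ℕ)) x₀) = 0 := by
    intro n w
    have hiter := cfTransfer_iterate_of_eigen hA heig n hx₀
    rw [hzero, mul_zero, cfTransfer_iterate hA s g n hx₀, cfTransferSum] at hiter
    have hnn : ∀ v ∈ (Finset.univ : Finset (Fin n → A)),
        0 ≤ ((cfDenom (cfMat fun i => (v i : ℕ)) x₀) ^ 2) ^ (-s) *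
          g (cfMoeb (cfMat fun i => (v i : ℕ)) x₀) :=
      fun v _ => mul_nonneg (Real.rpow_nonneg (sq_nonneg _) _)
        (hpos _ (cfMoeb_cfMat_mem (one_le_coe_digit hA v) hx₀))
    have hw := (Finset.sum_eq_zero_iff_of_nonneg hnn).1 hiter w (Finset.mem_univ w)
    have hwt : 0 < ((cfDenom (cfMat fun i => (w i : ℕ)) x₀) ^ 2) ^ (-s) :=
      Real.rpow_pos_of_pos (pow_pos (cfDenom_cfMat_pos (one_le_coe_digit hA w) hx₀) 2) _
    rcases mul_eq_zero.1 hw with h | h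
    · exact absurd h hwt.ne'
    · exact h
  -- the words `d|n`
  have hmat : ∀ n : ℕ, cfMat (fun i : Fin n => (((⟨d i, hdA i⟩ : A) : A) : ℕ)) = cfWord d n := fun n =>
    cfWord_congr fun i hi => by rw [cfExt_of_lt _ hi]
  have hz0 : ∀ n : ℕ, g (cfMoeb (cfWord d n) x₀) = 0 := fun n => by
    rw [← hmat n]; exact hterms n _
  have hzI : ∀ n : ℕ, cfMoeb (cfWord d n) x₀ ∈ Icc (0 : ℝ) 1 := fun n => by
    rw [← hmat n]; exact cfMoeb_cfMat_mem (one_le_coe_digit hA _) hx₀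
  have hyI : cfValue d ∈ Icc (0 : ℝ) 1 := cfValue_mem_Icc hd1
  -- `M_{d|n} x₀ → [0; d]` within `[0,1]`
  have happrox : Tendsto (fun n : ℕ => cfMoeb (cfWord d n) x₀) atTop (𝓝 (cfValue d)) := by
    rw [tendsto_iff_norm_sub_tendsto_zero]
    have hlim2 : Tendsto (fun n : ℕ => 4 * (1 / 2 : ℝ) ^ n) atTop (𝓝 0) := by
      have h := (tendsto_pow_atTop_nhds_zero_of_lt_one (by norm_num : (0 : ℝ) ≤ 1 / 2)
        (by norm_num)).const_mul (4 : ℝ)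
      rwa [mul_zero] at h
    refine squeeze_zero (fun n => norm_nonneg _) (fun n => ?_) hlim2
    rw [Real.norm_eq_abs]
    exact (abs_cfMoeb_sub_cfValue_le hd1 n hx₀).trans (two_div_cfDen_sq_le hA hd1 n)
  have hwithin : Tendsto (fun n : ℕ => cfMoeb (cfWord d n) x₀) atTop (𝓝[Icc 0 1] (cfValue d)) :=
    tendsto_nhdsWithin_iff.2 ⟨happrox, Eventually.of_forall hzI⟩
  have hg := ((hcont _ hyI).tendsto).comp hwithin
  have hg0 : Tendsto (fun n : ℕ => g (cfMoeb (cfWord d n) x₀)) atTop (𝓝 0) := by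
    simp only [hz0]; exact tendsto_const_nhds
  exact tendsto_nhds_unique hg hg0

/-- **Uniqueness of the positive eigenfunction** ([MageeOhWinter2019, Thm. 10 (2)], for `Γ_A`):
two Lipschitz functions on `[0,1]` with `L_s hᵢ = e^{P_A(s)} hᵢ` on `[0,1]` and `h₂ > 0` are
proportional on `[0,1]`. [cite: MageeOhWinter2019, Thm. 10] -/
theorem cfTransfer_eigenfunction_unique (hne : A.Nonempty) {s : ℝ} (hs : 0 ≤ s) {h₁ h₂ : ℝ → ℝ} {K₁ K₂ : ℝ}
    (hK₁ : ∀ x ∈ Icc (0 : ℝ) 1, ∀ y ∈ Icc (0 : ℝ) 1, |h₁ x - h₁ y| ≤ K₁ * |x - y|)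
    (hK₂ : ∀ x ∈ Icc (0 : ℝ) 1, ∀ y ∈ Icc (0 : ℝ) 1, |h₂ x - h₂ y| ≤ K₂ * |x - y|)
    (hpos₂ : ∀ x ∈ Icc (0 : ℝ) 1, 0 < h₂ x)
    (heig₁ : ∀ x ∈ Icc (0 : ℝ) 1, cfTransfer A s h₁ x = cfEig A s * h₁ x)
    (heig₂ : ∀ x ∈ Icc (0 : ℝ) 1, cfTransfer A s h₂ x = cfEig A s * h₂ x) :
    ∃ t : ℝ, ∀ x ∈ Icc (0 : ℝ) 1, h₁ x = t * h₂ x := by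
  -- continuity from the Lipschitz bounds
  have lip : ∀ {h : ℝ → ℝ} {K : ℝ}, (∀ x ∈ Icc (0 : ℝ) 1, ∀ y ∈ Icc (0 : ℝ) 1,
      |h x - h y| ≤ K * |x - y|) → ContinuousOn h (Icc 0 1) := by
    intro h K hK
    have hL : LipschitzOnWith K.toNNReal h (Icc 0 1) := by
      refine LipschitzOnWith.of_dist_le_mul fun x hx y hy => ?_
      rw [Real.dist_eq, Real.dist_eq]
      exact (hK x hx y hy).trans (mul_le_mul_of_nonneg_right (Real.le_coe_toNNReal K) (abs_nonneg _))
    exact hL.continuousOn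
  have hc₁ := lip hK₁
  have hc₂ := lip hK₂
  -- the ratio and its minimum on `[0,1]`
  have hcr : ContinuousOn (fun x => h₁ x / h₂ x) (Icc 0 1) :=
    hc₁.div hc₂ fun x hx => (hpos₂ x hx).ne'
  obtain ⟨x₀, hx₀, hmin⟩ := isCompact_Icc.exists_isMinOn (nonempty_Icc.2 zero_le_one) hcr
  refine ⟨h₁ x₀ / h₂ x₀, ?_⟩
  set t : ℝ := h₁ x₀ / h₂ x₀ with ht
  -- `g = h₁ - t h₂ ≥ 0`, an eigenfunction vanishing at `x₀`
  set g : ℝ → ℝ := fun x => h₁ x - t * h₂ x with hg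
  have hgpos : ∀ x ∈ Icc (0 : ℝ) 1, 0 ≤ g x := by
    intro x hx
    have hr : t ≤ h₁ x / h₂ x := isMinOn_iff.1 hmin x hx
    have h2 := hpos₂ x hx
    rw [le_div_iff₀ h2] at hr
    simp only [hg]
    linarith
  have hg0 : g x₀ = 0 := by
    simp only [hg, ht]
    rw [div_mul_cancel₀ _ (hpos₂ x₀ hx₀).ne', sub_self]
  have hgeig : ∀ x ∈ Icc (0 : ℝ) 1, cfTransfer A s g x = cfEig A s * g x := by
    intro x hx
    simp only [hg]
    rw [cfTransfer_sub_smul, heig₁ x hx, heig₂ x hx]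
    ring
  have hgK : ∀ x ∈ Icc (0 : ℝ) 1, ∀ y ∈ Icc (0 : ℝ) 1, |g x - g y| ≤ (|K₁| + |t| * |K₂|) * |x - y| := by
    intro x hx y hy
    have e : g x - g y = (h₁ x - h₁ y) - t * (h₂ x - h₂ y) := by simp only [hg]; ring
    rw [e]
    have h1 := hK₁ x hx y hy
    have h2 := hK₂ x hx y hy
    have ha : |x - y| ≥ 0 := abs_nonneg _
    calc |h₁ x - h₁ y - t * (h₂ x - h₂ y)| ≤ |h₁ x - h₁ y| + |t * (h₂ x - h₂ y)| := abs_sub _ _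
      _ = |h₁ x - h₁ y| + |t| * |h₂ x - h₂ y| := by rw [abs_mul]
      _ ≤ |K₁| * |x - y| + |t| * (|K₂| * |x - y|) := by
          gcongr
          · exact h1.trans (mul_le_mul_of_nonneg_right (le_abs_self K₁) ha)
          · exact h2.trans (mul_le_mul_of_nonneg_right (le_abs_self K₂) ha)
      _ = (|K₁| + |t| * |K₂|) * |x - y| := by ring
  have hgc : ContinuousOn g (Icc 0 1) := hc₁.sub (continuousOn_const.mul hc₂)
  have hvan := cfTransfer_eigen_vanish_on_cantor hA hgc hgpos hgeig hx₀ hg0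
  have hzero := cfTransfer_eigen_eq_zero_of_vanish_on_cantor hA hne hs hgK hvan hgeig
  intro x hx
  have := hzero x hx
  simp only [hg] at this
  linarith

end Unique

end Literature.NumberTheory.Sieve
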